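import Literature.MathematicalPhysics.QuantumFieldTheory.Balaban1983to89.B7Prop4GeneralLevels
import Literature.MathematicalPhysics.QuantumFieldTheory.Balaban1983to89.B9Eq332AvgCovariance

/-!
# `Balaban1983to89.B9Eq332FieldAvgCovariance` — B9 p. 396: *"the equalities (3.32) hold again"* for the averaging
# operators `Q_j(U)` of GAUGE FIELDS (3.13)–(3.15), PROVED for the concrete double-bar averages of the tree on `ℤ^d` under the
# transformations (3.28) `U → U^u, U′ → R(u)U′` — every invertible gauge function, every background, no smallness

HONEST FRAMING (cell `lit-balaban`, verbatim): statement-level skeleton of published theorems with citation tags; proofs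
where landed; nothing here is a claim about the Yang–Mills mass gap.

DOCFIX (cell `lit-balaban`, seat r06 gen 15, 2026-08-22; p37 `CITELOC-SWEEP-B4B9.md` §2b page-numeral slips, text layer re-read): (3.32) is p. 395 [PDF 7] ((3.33) p. 396) — the locators of (3.32) in this file corrected accordingly (5 place(s)); declarations, statements and proofs byte-identical to the tree copy of record (p250009).

CITATION HEADER (lean-in-tree rule).  T. Bałaban, *Propagators for lattice gauge theories in a background field*, Commun.
Math. Phys. **99** (1985) 389–434 [`Balaban1985BackgroundPropagators`] (cell paper B9; journal page = PDF page + 388),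
pp. 392–393 [PDF 4–5] (3.13)–(3.16), pp. 395–396 [PDF 7–8] (3.28), (3.32); the averaging objects are those of [5] = T. Bałaban,
*Averaging operations for lattice gauge theories*, Commun. Math. Phys. **98** (1985) 17–51 [`Balaban1985Averaging`]: (8) p. 18,
(11) p. 19, (42)–(43) p. 23–24, (56)–(58) p. 27, (62) p. 28, (65) p. 29, (82) p. 30, (89) p. 31, (121)–(122) p. 36, (124) p. 36,
(127) p. 37 and the composition rule p. 38.  Cell `lit-balaban` seat r06 gen 5 (B9 fold owner), SKELETON row `B9.Eq3.28`
(= (3.28)–(3.34)): the clause for `Q_j(U)`; companion of `B9Eq332AvgCovariance` (the transported averages `Q′_j(U)` of (3.19)).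
Text read from the held text layer `paper:balaban1985-cmp99-background-propagators` pp. 5, 7–8.

WHAT IS PRINTED.  p. 392–393: *"Q̄_j(U,ηA) = Q_j(U)A + C_j(U,ηA), (3.14) where Q_j(U)A is a linear part of the function (3.13)
… They are compositions of j one-step averaging operators Q_j(U) = Q(Ū^{j−1})·…·Q(Ū)Q(U), (3.15) where Q(V) is given by the
explicit formula (124) in [5]"*; (3.16) *"⟨A,Q\*aQA⟩ = Σ_{j=0}^{k} Σ_{b∈Λ_j} (Lʲη)^{d−2}|(Q_j(U)A)(b)|²"*; p. 395 (3.28) *"U → U^u,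
U′ → R(u)U′, where U^u(x,x′) = u(x)U(x,x′)u⁻¹(x′), (R(u)U′)(x,x′) = R(u(x))U′(x,x′)"*, *"Of course R(u(x)) exp iηA(x,x′) =
exp iηR(u(x))A(x,x′) and R(u)A is linear in A"*; p. 396, after (3.33): *"Finally inspecting the definitions of the averaging
operators Q_j(U) for gauge fields we can see that the equalities (3.32) hold again. This implies the transformation laws for
the operators Δ_a and G …"*, (3.32) being *"(Q′_j(U^u)R(u)λ)(y) = R(u(y))(Q′_j(U)λ)(y), and Q′\*(U^u)aQ′(U^u) = R(u)Q′\*(U)aQ′(U)R(u⁻¹)"*.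

CARRIERS (REUSED BY NAME; nothing restated; every level read on `ℤ^d`).  Row B9.Eq3.13 identifies (3.13)/(3.14)–(3.15) with the
tree's [5]-objects at a general background: `B7Prop3GeneralLinear.Qcov` ((121) `Q(V₀,A,c) = (1/i) log (V̿₁)_c`, `V₁ = e^{A}`,
double-bar average (89) `B7Eq92Concrete.dbavgCov` built from the block frame `wframe = exp Fcov` (62)/(82), the twisted transport
`tHol` (58) and `tild` (65)), `B7Prop3GeneralLinear.linQcov` ((122)/(124): the linear part, as the `t`-derivative at `0`),
and the composites `B7Prop4GeneralLevels.logCovIter` (= (3.13) `Q̄_j(U,·)`) / `linCovIter` (= (3.15) `LʲQ_j(U)`, p. 38 of [5]) over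
the tower `Ū^l = avgIter L U l` (43); gauge action `gaugeAct` (8) = `U^u`; `R(X)Y = XYX⁻¹` = `Rc` (units) / `conjR` (vectors);
`u_l(z) = u(Lˡz)` = `B7AvgGaugeCovariance.uLev`.  The rotated objects of (3.28) are written pointwise: `R(u)U′ = fun x κ ↦
R(u(x))U′(x,κ)`, `R(u)A = fun x κ ↦ R(u(x))A(x,κ)` (no new definition).

WHAT THIS FILE PROVES (theorems only; 0 definitions, 0 `Prop` placeholders; axioms standard).  For EVERY background `V₀`/`U₀`,
EVERY configuration `V₁`, EVERY field `A` and EVERY invertible gauge function `u` (values in the units of a complete normed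
ℂ-algebra `𝔸`):
* §1 `rot_mul_gaugeAct` (*"U′ → R(u)U′"* composes with *"U → U^u"* to `(U′U)^u`), `expCfg_rot` (*"R(u(x)) exp iηA = exp iηR(u(x))A"*),
  `tHol_rot` (the twisted transport (58) is conjugated by `u(y)`), `Fcov_rot`, `wframe_rot` (the block frame (62)/(82) is
  conjugated), `tild_rot` ((65)), **`dbavgCov_rot`** (the double-bar average (89): `V̿₁[V₀^u, R(u)V₁](c) = R(u(c₋))V̿₁[V₀,V₁](c)`).
* §2 **`Qcov_rot`**: `Q(V₀^u, R(u)A, c) = R(u(c₋))Q(V₀, A, c)` ((121), the non-linear one-step average); **`logCovIter_rot`**: the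
  composite (3.13) `Q̄_j(U^u, R(u)A) = R(u_j)Q̄_j(U, A)` (with [5] (11) for the tower, `B7Prop6Flat.avgIter_gaugeAct_units`).
* §3 (private `deriv_conjR`: a derivative passes through the invertible conjugation `R(X)`, with or without differentiability),
  **`linQcov_rot`**: `Q(V₀^u)R(u)A = R(u(c₋))Q(V₀)A` ((122)/(124), *"R(u)A is linear in A"*), **`linCovIter_rot`** = (3.32) FOR
  `Q_j(U)`: `Q_j(U^u)R(u)A = R(u_j)Q_j(U)A`.
* §4 for `u ∈ U1` (isometric `R(u)`): `norm_linCovIter_rot` and `form316_gaugeAct` — the summands `|(Q_j(U)A)(b)|²` of (3.16) are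
  gauge invariant, i.e. *"Q\*(U^u)aQ(U^u) = R(u)Q\*(U)aQ(U)R(u⁻¹)"* at the level of the defining quadratic form (the input of (3.34)).

NOT CLAIMED: (3.34) itself (`B9Eq333Cov.lapFull_intertwine`/`G_intertwine`, abstract intertwining model, take these laws as
hypotheses `h32`-shapes — discharged here in the concrete `ℤ^d` model, not re-bridged); the normalization `L^{−j}` between
`linCovIter` and the print's `Q_j(U)` (a scalar, commutes with `R(u)`); moving frames (55)–(59) (`B7Eq92Concrete.tild_mgauge`) are a
different action and are not used.
-/

noncomputable section

open scoped BigOperators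

namespace Literature.MathematicalPhysics.QuantumFieldTheory.Balaban1983to89.B9Eq332FieldAvgCovariance

open B7Prop1Explicit B7Prop2Explicit B7Prop3Flat B7Eq92Concrete B7Prop3GeneralLinear B7Prop4GeneralLevels MatrixLog
open B7AvgGaugeCovariance (uLev uLev_apply uLev_smul uLev_zero uLev_mem)
open B7Prop6Flat (avgIter_gaugeAct_units bavg_gaugeAct_units mlog_conj)
open B7Eq78Linearization (conjR conjR_apply conjR_smul)
open B8Ineq132 (norm_conjR)

variable {d : ℕ}

/-! ## §1 The objects of [5] (58), (62)/(82), (65), (89) under `U → U^u, U′ → R(u)U′` (3.28) -/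

section Group

variable {G : Type*} [Group G]

/-- **(3.28) on the product**: `(R(u)U′)·U^u = (U′U)^u` bondwise (*"U → U^u, U′ → R(u)U′"*; the pair of substitutions is the
ordinary gauge transformation (8) of [5] of the full configuration `U′U`). [cite: Balaban1985BackgroundPropagators, (3.28) p.395; Balaban1985Averaging, (8) p.18] -/
theorem rot_mul_gaugeAct (u : B7Prop1Explicit.Site d → G) (V₀ V₁ : B7Prop1Explicit.Site d → Fin d → G) :
    (fun x κ => Rc (u x) (V₁ x κ)) * gaugeAct u V₀ = gaugeAct u (V₁ * V₀) := by
  funext x κ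
  simp only [Pi.mul_apply, gaugeAct, Rc_apply]
  group

/-- **The twisted transport (58) of [5] under (3.28)**: `(R_{0,y}[V₀^u] R(u)V₁)(Γ) = u(y)·(R_{0,y}[V₀]V₁)(Γ)·u(y)⁻¹` for every
contour `Γ` from `y` (telescoping of (8) along `Γ` for `V₁V₀` and for `V₀`).
[cite: Balaban1985BackgroundPropagators, (3.28) p.395, (3.32) p.395; Balaban1985Averaging, (58) p.27, (8) p.18] -/
theorem tHol_rot (u : B7Prop1Explicit.Site d → G) (V₀ V₁ : B7Prop1Explicit.Site d → Fin d → G) (y : B7Prop1Explicit.Site d)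
    (w : List (Letter d)) :
    tHol (gaugeAct u V₀) (fun x κ => Rc (u x) (V₁ x κ)) y w = u y * tHol V₀ V₁ y w * (u y)⁻¹ := by
  unfold tHol
  rw [rot_mul_gaugeAct, hol_gaugeAct, hol_gaugeAct]
  group

end Group

section Frames

variable {𝔸 : Type*} [NormedRing 𝔸] [NormedAlgebra ℂ 𝔸] [CompleteSpace 𝔸]

/-- p. 395: *"Of course R(u(x)) exp iηA(x,x′) = exp iηR(u(x))A(x,x′)"* — `e^{R(u)A} = R(u)e^{A}` bondwise ([5] (57) for `exp`,
`B7Eq92Concrete.expUnit_conj`). [cite: Balaban1985BackgroundPropagators, (3.28) p.395; Balaban1985Averaging, (57) p.27] -/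
theorem expCfg_rot (u : B7Prop1Explicit.Site d → 𝔸ˣ) (A : B7Prop1Explicit.Site d → Fin d → 𝔸) :
    expCfg (fun x κ => conjR (u x) (A x κ)) = fun x κ => Rc (u x) (expCfg A x κ) := by
  funext x κ
  simp only [expCfg, conjR_apply, expUnit_conj]

omit [CompleteSpace 𝔸] in
/-- **The exponent `F(y)` of the block frame (62)/(82) under (3.28)** is conjugated by `u(y)` (its summands are logarithms of
twisted transports from `y`; *"their logarithms are unitarily equivalent"* [5] p. 24, for every unit: `B7Prop6Flat.mlog_conj`).
[cite: Balaban1985BackgroundPropagators, (3.28) p.395; Balaban1985Averaging, (62) p.28, (82) p.30, p.24] -/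
theorem Fcov_rot (L : ℕ) (u : B7Prop1Explicit.Site d → 𝔸ˣ) (V₀ V₁ : B7Prop1Explicit.Site d → Fin d → 𝔸ˣ)
    (y : B7Prop1Explicit.Site d) :
    Fcov L (gaugeAct u V₀) (fun x κ => Rc (u x) (V₁ x κ)) y = (u y : 𝔸) * Fcov L V₀ V₁ y * (((u y)⁻¹ : 𝔸ˣ) : 𝔸) := by
  unfold Fcov
  rw [Finset.mul_sum, Finset.sum_mul]
  refine Finset.sum_congr rfl fun r _ => ?_
  rw [tHol_rot, Units.val_mul, Units.val_mul, mlog_conj, ← smul_mul_assoc, ← mul_smul_comm]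

/-- **The block frame `\overline{R_{0,y}V₁} = e^{F(y)}` (82) under (3.28)**: `R`-conjugated by `u(y)`.
[cite: Balaban1985BackgroundPropagators, (3.28) p.395; Balaban1985Averaging, (82) p.30, (62) p.28] -/
theorem wframe_rot (L : ℕ) (u : B7Prop1Explicit.Site d → 𝔸ˣ) (V₀ V₁ : B7Prop1Explicit.Site d → Fin d → 𝔸ˣ)
    (y : B7Prop1Explicit.Site d) :
    wframe L (gaugeAct u V₀) (fun x κ => Rc (u x) (V₁ x κ)) y = Rc (u y) (wframe L V₀ V₁ y) := by
  unfold wframe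
  rw [Fcov_rot, expUnit_conj]

/-- **(65) `Ṽ₁ = (\overline{V₁V₀})_c(V̄₀)_c⁻¹` under (3.28)**: conjugated by `u(c₋)` ((11) of [5] for the two one-step averages, every
invertible `u`: `B7Prop6Flat.bavg_gaugeAct_units`). [cite: Balaban1985BackgroundPropagators, (3.28) p.395; Balaban1985Averaging, (65) p.29, (11) p.19] -/
theorem tild_rot (L : ℕ) (u : B7Prop1Explicit.Site d → 𝔸ˣ) (V₀ V₁ : B7Prop1Explicit.Site d → Fin d → 𝔸ˣ)
    (q : B7Prop1Explicit.Site d) (κ : Fin d) :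
    tild L (gaugeAct u V₀) (fun x κ => Rc (u x) (V₁ x κ)) q κ = Rc (u q) (tild L V₀ V₁ q κ) := by
  rw [tild_apply, tild_apply, rot_mul_gaugeAct, bavg_gaugeAct_units, bavg_gaugeAct_units, Rc_apply]
  group

/-- **THE DOUBLE-BAR AVERAGE (89) of [5] under (3.28)**: `V̿₁[V₀^u, R(u)V₁](c) = R(u(c₋))·V̿₁[V₀, V₁](c)` — every background,
every `V₁`, every invertible `u`. [cite: Balaban1985BackgroundPropagators, (3.28) p.395, (3.32) p.395–396; Balaban1985Averaging, (89) p.31] -/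
theorem dbavgCov_rot (L : ℕ) (u : B7Prop1Explicit.Site d → 𝔸ˣ) (V₀ V₁ : B7Prop1Explicit.Site d → Fin d → 𝔸ˣ)
    (q : B7Prop1Explicit.Site d) (κ : Fin d) :
    dbavgCov L (gaugeAct u V₀) (fun x κ => Rc (u x) (V₁ x κ)) q κ = Rc (u q) (dbavgCov L V₀ V₁ q κ) := by
  rw [dbavgCov_apply, dbavgCov_apply, wframe_rot, wframe_rot, tild_rot, bavg_gaugeAct_units]
  simp only [Rc_apply]
  group

end Frames

/-! ## §2 (121) and the composite (3.13): `Q(V₀^u, R(u)A) = R(u)Q(V₀, A)` -/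

section Nonlinear

variable {𝔸 : Type*} [NormedRing 𝔸] [NormedAlgebra ℂ 𝔸] [CompleteSpace 𝔸]

/-- **(121) under (3.28)**: `Q(V₀^u, R(u)A, c) = R(u(c₋))Q(V₀, A, c)` for the non-linear one-step average `Q(V₀,A,c) = (1/i)log(V̿₁)_c`
(`B7Prop3GeneralLinear.Qcov`), every `V₀`, `A`, invertible `u`. [cite: Balaban1985BackgroundPropagators, (3.28) p.395, (3.32) p.395; Balaban1985Averaging, (121) p.36, p.24] -/
theorem Qcov_rot (L : ℕ) (u : B7Prop1Explicit.Site d → 𝔸ˣ) (V₀ : B7Prop1Explicit.Site d → Fin d → 𝔸ˣ)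
    (A : B7Prop1Explicit.Site d → Fin d → 𝔸) (q : B7Prop1Explicit.Site d) (κ : Fin d) :
    Qcov L (gaugeAct u V₀) (fun x κ => conjR (u x) (A x κ)) q κ = conjR (u q) (Qcov L V₀ A q κ) := by
  rw [Qcov, Qcov, expCfg_rot, dbavgCov_rot, Rc_apply, Units.val_mul, Units.val_mul, mlog_conj, conjR_apply]

/-- **(3.13) under (3.28) — the composite non-linear average**: `Q̄_j(U^u, R(u)A) = R(u_j)Q̄_j(U, A)` bondwise on the level-`j`
lattice (`u_j(z) = u(Lʲz)`), from `Qcov_rot` at every level and the covariance (11) of the tower `\overline{(U^u)}^l = (Ū^l)^{u_l}`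
(`B7Prop6Flat.avgIter_gaugeAct_units`). [cite: Balaban1985BackgroundPropagators, (3.13) p.392, (3.32) p.395; Balaban1985Averaging, (127) p.37, p.38, (11) p.19] -/
theorem logCovIter_rot (L : ℕ) (u : B7Prop1Explicit.Site d → 𝔸ˣ) (U₀ : B7Prop1Explicit.Site d → Fin d → 𝔸ˣ)
    (B : B7Prop1Explicit.Site d → Fin d → 𝔸) :
    ∀ (j : ℕ) (z : B7Prop1Explicit.Site d) (κ : Fin d),
      logCovIter L (gaugeAct u U₀) (fun x κ => conjR (u x) (B x κ)) j z κ = conjR (uLev L u j z) (logCovIter L U₀ B j z κ)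
  | 0, z, κ => by rw [logCovIter_zero, logCovIter_zero, uLev_zero]
  | j + 1, z, κ => by
      have ih : logCovIter L (gaugeAct u U₀) (fun x κ => conjR (u x) (B x κ)) j
          = fun x κ => conjR (uLev L u j x) (logCovIter L U₀ B j x κ) :=
        funext fun x => funext fun κ => logCovIter_rot L u U₀ B j x κ
      rw [logCovIter_succ, logCovIter_succ, avgIter_gaugeAct_units L u U₀ j, ih, Qcov_rot, uLev_smul]

end Nonlinear

/-! ## §3 (122)/(124) and the composite (3.15): `Q_j(U^u)R(u)A = R(u_j)Q_j(U)A` — (3.32) for `Q_j(U)` -/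

section Linear

variable {𝔸 : Type*} [NormedRing 𝔸] [NormedAlgebra ℂ 𝔸] [CompleteSpace 𝔸]

omit [CompleteSpace 𝔸] in
/-- A derivative passes through the invertible conjugation `R(X)Y = XYX⁻¹` — with no differentiability hypothesis: if `g` is
not differentiable at `x` then neither is `R(X)g` (else `g = R(X⁻¹)R(X)g` would be), and both sides are `0`. [folklore] -/
private theorem deriv_conjR (X : 𝔸ˣ) (g : ℂ → 𝔸) (x : ℂ) :
    deriv (fun t => conjR X (g t)) x = conjR X (deriv g x) := by
  by_cases hg : DifferentiableAt ℂ g x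
  · simp only [conjR_apply]
    rw [deriv_mul_const (hg.const_mul _), deriv_const_mul _ hg]
  · have hg' : ¬DifferentiableAt ℂ (fun t => conjR X (g t)) x := by
      intro h
      apply hg
      have h2 : DifferentiableAt ℂ (fun t => conjR X⁻¹ (conjR X (g t))) x := by
        simp only [conjR_apply]
        exact (h.const_mul _).mul_const _
      simp only [B9Eq332AvgCovariance.conjR_inv_conjR] at h2
      exact h2
    rw [deriv_zero_of_not_differentiableAt hg, deriv_zero_of_not_differentiableAt hg']
    simp [conjR_apply]

/-- **(122)/(124) under (3.28)**: `(Q(V₀^u)R(u)A)_c = R(u(c₋))(Q(V₀)A)_c` — the LINEAR part of (121) (*"R(u)A is linear in A,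
hence expanding both sides … we get a sequence of equalities between homogeneous polynomials"*, p. 395), every `V₀`, `A`,
invertible `u`. [cite: Balaban1985BackgroundPropagators, (3.28)–(3.29) p.395, (3.32) p.395; Balaban1985Averaging, (122) p.36, (124) p.36] -/
theorem linQcov_rot (L : ℕ) (u : B7Prop1Explicit.Site d → 𝔸ˣ) (V₀ : B7Prop1Explicit.Site d → Fin d → 𝔸ˣ)
    (A : B7Prop1Explicit.Site d → Fin d → 𝔸) (q : B7Prop1Explicit.Site d) (κ : Fin d) :
    linQcov L (gaugeAct u V₀) (fun x κ => conjR (u x) (A x κ)) q κ = conjR (u q) (linQcov L V₀ A q κ) := by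
  unfold linQcov
  have h : (fun t : ℂ => Qcov L (gaugeAct u V₀) (t • fun x κ => conjR (u x) (A x κ)) q κ)
      = fun t : ℂ => conjR (u q) (Qcov L V₀ (t • A) q κ) := by
    funext t
    have hs : (t • fun x κ => conjR (u x) (A x κ)) = fun x κ => conjR (u x) ((t • A) x κ) := by
      funext x κ
      simp only [Pi.smul_apply, conjR_smul]
    rw [hs, Qcov_rot]
  rw [h, deriv_conjR]

/-- **(3.32) FOR THE GAUGE-FIELD AVERAGES `Q_j(U)` of (3.14)–(3.15)** (p. 396: *"inspecting the definitions of the averaging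
operators Q_j(U) for gauge fields we can see that the equalities (3.32) hold again"*): `Q_j(U^u)R(u)A = R(u_j)Q_j(U)A` bondwise on
the level-`j` lattice, for the composite `B7Prop4GeneralLevels.linCovIter` (= `LʲQ_j(U)`; the scalar normalization commutes with
`R`), every `U`, `A`, invertible `u`. [cite: Balaban1985BackgroundPropagators, (3.32) p.395–396, (3.14)–(3.15) p.393; Balaban1985Averaging, p.38, (11) p.19] -/
theorem linCovIter_rot (L : ℕ) (u : B7Prop1Explicit.Site d → 𝔸ˣ) (U₀ : B7Prop1Explicit.Site d → Fin d → 𝔸ˣ)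
    (B : B7Prop1Explicit.Site d → Fin d → 𝔸) :
    ∀ (j : ℕ) (z : B7Prop1Explicit.Site d) (κ : Fin d),
      linCovIter L (gaugeAct u U₀) (fun x κ => conjR (u x) (B x κ)) j z κ = conjR (uLev L u j z) (linCovIter L U₀ B j z κ)
  | 0, z, κ => by rw [linCovIter_zero, linCovIter_zero, uLev_zero]
  | j + 1, z, κ => by
      have ih : linCovIter L (gaugeAct u U₀) (fun x κ => conjR (u x) (B x κ)) j
          = fun x κ => conjR (uLev L u j x) (linCovIter L U₀ B j x κ) :=
        funext fun x => funext fun κ => linCovIter_rot L u U₀ B j x κ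
      rw [linCovIter_succ, linCovIter_succ, avgIter_gaugeAct_units L u U₀ j, ih, linQcov_rot, uLev_smul]

end Linear

/-! ## §4 `u ∈ U1`: the summands of the form (3.16) are gauge invariant -/

section Norms

variable {𝔸 : Type*} [NormedRing 𝔸] [NormOneClass 𝔸] [NormedAlgebra ℂ 𝔸] [CompleteSpace 𝔸]

/-- For `u` with `|u|, |u⁻¹| ≦ 1` (`U1`): `|(Q_j(U^u)R(u)A)(b)| = |(Q_j(U)A)(b)|`.
[cite: Balaban1985BackgroundPropagators, (3.32) p.395, (3.16) p.393] -/
theorem norm_linCovIter_rot (L : ℕ) {u : B7Prop1Explicit.Site d → 𝔸ˣ} (hu : ∀ x, u x ∈ U1 𝔸)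
    (U₀ : B7Prop1Explicit.Site d → Fin d → 𝔸ˣ) (B : B7Prop1Explicit.Site d → Fin d → 𝔸) (j : ℕ)
    (z : B7Prop1Explicit.Site d) (κ : Fin d) :
    ‖linCovIter L (gaugeAct u U₀) (fun x κ => conjR (u x) (B x κ)) j z κ‖ = ‖linCovIter L U₀ B j z κ‖ := by
  rw [linCovIter_rot, norm_conjR (uLev_mem hu L j z)]

/-- **The second clause of (3.32) for `Q_j(U)`, at the level of the defining form (3.16)** `⟨A,Q*aQA⟩ = Σ_j Σ_{b∈Λ_j}
(Lʲη)^{d−2}|(Q_j(U)A)(b)|²`: the form takes the same value at `(U^u, R(u)A)` as at `(U, A)`, for every finite family of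
(level, site, direction, weight) — *"Q*(U^u)aQ(U^u) = R(u)Q*(U)aQ(U)R(u⁻¹)"*, the input of (3.34).
[cite: Balaban1985BackgroundPropagators, (3.32) p.395, (3.34) p.396, (3.16) p.393] -/
theorem form316_gaugeAct (L : ℕ) {u : B7Prop1Explicit.Site d → 𝔸ˣ} (hu : ∀ x, u x ∈ U1 𝔸)
    (U₀ : B7Prop1Explicit.Site d → Fin d → 𝔸ˣ) (B : B7Prop1Explicit.Site d → Fin d → 𝔸) {ι : Type*} (s : Finset ι)
    (lev : ι → ℕ) (site : ι → B7Prop1Explicit.Site d) (dir : ι → Fin d) (w : ι → ℝ) :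
    ∑ i ∈ s, w i * ‖linCovIter L (gaugeAct u U₀) (fun x κ => conjR (u x) (B x κ)) (lev i) (site i) (dir i)‖ ^ 2
      = ∑ i ∈ s, w i * ‖linCovIter L U₀ B (lev i) (site i) (dir i)‖ ^ 2 := by
  simp only [norm_linCovIter_rot L hu]

end Norms

end Literature.MathematicalPhysics.QuantumFieldTheory.Balaban1983to89.B9Eq332FieldAvgCovariance
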